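import Literature.Computability.Cryptography.PeriodFindingClassSums
import Literature.Computability.Cryptography.PeriodFindingShiftCell
import HarnessLib

/-!
# The twisted class sums of a shift-cell / coset table are jittered class sums

Topic `Computability/Cryptography` (harmonic analysis of period finding); theorem-only file, no named facts.
Joins `PeriodFindingShiftCell.lean` (`corrMass_shiftCell`: the autocorrelation mass of a shift-cell table at `c = a k'`
is `a² ∑_g |S_g(k')|² corrMass_S(C_g, k')` with the TWISTED CLASS SUMS `S_g(k') = ∑_{cls E = g} chr_{WSa}(a k' E) chr_S(−k' σ_E)`)
to `PeriodFindingClassSums.lean` (jittered class sums `Z(ν) = ∑_{cls E = g} e(θ_ν·d(E)) ψ(E)` over the digit vectors).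

For a coset table whose integer shifts `σ_E` are within `1` of reals `y_E` that are EXACT-AFFINE along the classes
(`y_{E'} − y_E + S μ·(d(E') − d(E)) ∈ Sℤ`), write `k' = k₀ + Sν` and let `kk ≡ k₀ (mod S)` (the signed residue). Then
(`twistedClassSum_norm_eq`) `|S_g(k₀ + Sν)| = |Z(ν)|` for the base angles `x_t = k₀/(S M^{T−t}) + kk μ_t` and the
EXPLICIT unimodular jitter `ψ(E) = e(−kk(σ_E − y_E)/S)`, which satisfies `|ψ(E) − 1| ≤ 2π|kk|/S` (`norm_jitter_sub_one_le`):
the affine part of the shift is a character (it only moves the peak by `kk μ`), the rounding is a small jitter.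
Also: `chr`/`corrMass` are `S`-periodic in the frequency (`chr_add_mul_self`, `corrMass_add_mul_self`).

## References

* S. Hallgren, STOC 2005, §4. [Hallgren2005]
* A. Yu. Kitaev, arXiv:quant-ph/9511026 (1995), §4. [Kitaev1995]
-/

noncomputable section

namespace Literature.Computability.Cryptography

namespace PeriodFinding

open Complex Finset

variable {T : ℕ}

/-! ### Bookkeeping on `chr`, `corrMass`, `cexp` -/

/-- `chr` is additive in the frequency. [folklore] -/
theorem chr_add_left (Q : ℕ) (c c' v : ℤ) : chr Q (c + c') v = chr Q c v * chr Q c' v := by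
  rw [chr_comm, chr_add, chr_comm Q v c, chr_comm Q v c']

/-- `chr S` is `S`-periodic in the frequency. [folklore] -/
theorem chr_add_mul_self (S : ℕ) (hS : 0 < S) (k m v : ℤ) : chr S (k + S * m) v = chr S k v := by
  rw [chr_add_left, chr_comm S ((S : ℤ) * m) v, chr_mul_self_left S hS, mul_one]

variable {Ω : Type*} [DecidableEq Ω] in
/-- The autocorrelation mass is `S`-periodic in the frequency. [folklore] -/
theorem corrMass_add_mul_self (S : ℕ) (hS : 0 < S) (C : ℕ → Ω) (k m : ℤ) :
    corrMass S C (k + S * m) = corrMass S C k := by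
  unfold corrMass
  simp_rw [chr_add_mul_self S hS]

/-- `chr` as the exponential of a real phase. [folklore] -/
theorem chr_eq_cexp_real (Q : ℕ) (c v : ℤ) : chr Q c v = cexp (2 * Real.pi * I * (((c : ℝ) * v / Q : ℝ) : ℂ)) := by
  rw [chr_def]; push_cast; ring_nf

/-- Exponentials of real phases multiply by adding the phases. [folklore] -/
theorem cexp_real_mul_cexp_real (r r' : ℝ) :
    cexp (2 * Real.pi * I * (r : ℂ)) * cexp (2 * Real.pi * I * (r' : ℂ)) = cexp (2 * Real.pi * I * ((r + r' : ℝ) : ℂ)) := by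
  rw [← Complex.exp_add]; push_cast; ring_nf

/-- Real phases differing by an integer give the same exponential. [folklore] -/
theorem cexp_real_eq_of_eq_add_int {r r' : ℝ} (n : ℤ) (h : r = r' + n) :
    cexp (2 * Real.pi * I * (r : ℂ)) = cexp (2 * Real.pi * I * (r' : ℂ)) := by
  rw [h]
  push_cast
  rw [mul_add, Complex.exp_add, show 2 * (Real.pi : ℂ) * I * (n : ℂ) = (n : ℂ) * (2 * Real.pi * I) by ring,
    Complex.exp_int_mul_two_pi_mul_I, mul_one]

/-- `|e(f) − 1| ≤ 2π|f|`. [folklore] -/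
theorem norm_cexp_real_sub_one_le (f : ℝ) : ‖cexp (2 * Real.pi * I * (f : ℂ)) - 1‖ ≤ 2 * Real.pi * |f| := by
  refine (norm_exp_sub_one_le f).trans ?_
  have h : min (Int.fract f) (1 - Int.fract f) ≤ |f| := by
    rw [← abs_sub_round_eq_min]
    simpa using round_le f 0
  have hpi : 0 ≤ 2 * Real.pi := by positivity
  exact mul_le_mul_of_nonneg_left h hpi

/-- The norm of `e(f)` is one. [folklore] -/
theorem norm_cexp_real (f : ℝ) : ‖cexp (2 * Real.pi * I * (f : ℂ))‖ = 1 := by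
  rw [show 2 * (Real.pi : ℂ) * I * (f : ℂ) = ((2 * Real.pi * f : ℝ) : ℂ) * I by push_cast; ring]
  exact Complex.norm_exp_ofReal_mul_I _

/-! ### The jitter -/

/-- **The rounding jitter is close to `1`**: for `|σ_E − y_E| ≤ 1`, `ψ(E) = e(−kk(σ_E − y_E)/S)` has norm one and
`|ψ(E) − 1| ≤ 2π|kk|/S`. [folklore] -/
theorem norm_jitter_sub_one_le {S : ℕ} (hS : 0 < S) (kk : ℤ) {σE yE : ℝ} (h : |σE - yE| ≤ 1) :
    ‖cexp (2 * Real.pi * I * ((-(kk : ℝ) * (σE - yE) / S : ℝ) : ℂ))‖ = 1 ∧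
      ‖cexp (2 * Real.pi * I * ((-(kk : ℝ) * (σE - yE) / S : ℝ) : ℂ)) - 1‖ ≤ 2 * Real.pi * |(kk : ℝ)| / S := by
  refine ⟨norm_cexp_real _, (norm_cexp_real_sub_one_le _).trans ?_⟩
  have hSR : (0 : ℝ) < S := by exact_mod_cast hS
  have h1 : |(-(kk : ℝ) * (σE - yE) / S : ℝ)| ≤ |(kk : ℝ)| / S := by
    rw [abs_div, abs_of_pos hSR, div_le_div_iff_of_pos_right hSR, abs_mul, abs_neg]
    calc |(kk : ℝ)| * |σE - yE| ≤ |(kk : ℝ)| * 1 := by gcongr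
      _ = |(kk : ℝ)| := mul_one _
  calc 2 * Real.pi * |(-(kk : ℝ) * (σE - yE) / S : ℝ)| ≤ 2 * Real.pi * (|(kk : ℝ)| / S) := by gcongr
    _ = 2 * Real.pi * |(kk : ℝ)| / S := by ring

/-! ### The twisted class sum -/

/-- **The twisted class sum of a coset table is a jittered class sum.** For a class table `cls` on `[0, M^T)` with
shifts `σ_E` and exact-affine reals `y_E` (`y_{E'} − y_E + S μ·(d(E') − d(E)) ∈ Sℤ` along the classes), a residue `k₀`,
a frequency block `ν` and `kk ≡ k₀ (mod S)`:
`|∑_{cls E = cls E₀} chr_{M^T S a}(a(k₀+Sν) E) chr_S(−(k₀+Sν) σ_E)| = |∑_{cls E = cls E₀} e(θ_ν·d(E)) e(−kk(σ_E − y_E)/S)|`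
with `θ_ν t = k₀/(S M^{T−t}) + kk μ_t + ν/M^{T−t}`. [cite: Hallgren2005, §4] -/
theorem twistedClassSum_norm_eq : ∀ {T M S a : ℕ}, 0 < M → 0 < S → 0 < a → ∀ (cls σ : ℕ → ℕ) (y : ℕ → ℝ)
    (μ : Fin T → ℝ), (∀ E < M ^ T, ∀ E' < M ^ T, cls E = cls E' → ∃ z : ℤ, y E' - y E + S * ∑ t : Fin T, μ t *
      (((E' / M ^ (t : ℕ) % M : ℕ) : ℝ) - ((E / M ^ (t : ℕ) % M : ℕ) : ℝ)) = S * z) →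
    ∀ {E₀ : ℕ}, E₀ < M ^ T → ∀ (k₀ ν : ℕ) (kk : ℤ), (∃ m : ℤ, (k₀ : ℤ) = kk + S * m) →
    ‖∑ E ∈ (Finset.range (M ^ T)).filter (fun E => cls E = cls E₀),
        chr (M ^ T * (S * a)) ((a * (k₀ + S * ν) : ℕ) : ℤ) E * chr S ((k₀ + S * ν : ℕ) : ℤ) (-(σ E : ℤ))‖ =
      ‖∑ E ∈ (Finset.range (M ^ T)).filter (fun E => cls E = cls E₀),
        eR (fun t => ((k₀ : ℝ) / ((S : ℝ) * (M : ℝ) ^ (T - (t : ℕ))) + (kk : ℝ) * μ t) + (ν : ℝ) / (M : ℝ) ^ (T - (t : ℕ)))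
          (toZ fun t : Fin T => E / M ^ (t : ℕ) % M) *
        Complex.exp (2 * Real.pi * Complex.I * ((-(kk : ℝ) * ((σ E : ℝ) - y E) / S : ℝ) : ℂ))‖ := by
  intro T M S a hM hS ha cls σ y μ hy E₀ hE₀ k₀ ν kk hkk
  obtain ⟨m, hm⟩ := hkk
  have hMR : (M : ℝ) ≠ 0 := by exact_mod_cast hM.ne'
  have hSR : (S : ℝ) ≠ 0 := by exact_mod_cast hS.ne'
  have haR : (a : ℝ) ≠ 0 := by exact_mod_cast ha.ne'
  have hWR : (M : ℝ) ^ T ≠ 0 := pow_ne_zero _ hMR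
  -- the unimodular constant relating the two sums
  set rK : ℝ := -(kk : ℝ) * (y E₀ / S + ∑ t : Fin T, μ t * ((E₀ / M ^ (t : ℕ) % M : ℕ) : ℝ)) with hrK
  suffices hterm : ∀ E ∈ (Finset.range (M ^ T)).filter (fun E => cls E = cls E₀),
      chr (M ^ T * (S * a)) ((a * (k₀ + S * ν) : ℕ) : ℤ) E * chr S ((k₀ + S * ν : ℕ) : ℤ) (-(σ E : ℤ)) =
      cexp (2 * Real.pi * I * (rK : ℂ)) *
        (eR (fun t => ((k₀ : ℝ) / ((S : ℝ) * (M : ℝ) ^ (T - (t : ℕ))) + (kk : ℝ) * μ t) + (ν : ℝ) / (M : ℝ) ^ (T - (t : ℕ)))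
          (toZ fun t : Fin T => E / M ^ (t : ℕ) % M) *
        cexp (2 * Real.pi * I * ((-(kk : ℝ) * ((σ E : ℝ) - y E) / S : ℝ) : ℂ))) by
    rw [sum_congr rfl hterm, ← mul_sum, norm_mul, norm_cexp_real, one_mul]
  intro E hE
  obtain ⟨hEW, hcl⟩ := mem_filter.1 hE
  have hEW' : E < M ^ T := mem_range.1 hEW
  obtain ⟨z, hz⟩ := hy E₀ hE₀ E hEW' hcl.symm
  -- every factor as the exponential of a real phase
  have h1 : chr (M ^ T * (S * a)) ((a * (k₀ + S * ν) : ℕ) : ℤ) E =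
      cexp (2 * Real.pi * I * ((((k₀ : ℝ) + S * ν) * E / ((M : ℝ) ^ T * S) : ℝ) : ℂ)) := by
    rw [chr_eq_cexp_real]
    congr 3
    push_cast
    field_simp
  have h2 : chr S ((k₀ + S * ν : ℕ) : ℤ) (-(σ E : ℤ)) =
      cexp (2 * Real.pi * I * ((-((k₀ : ℝ) + S * ν) * (σ E : ℝ) / S : ℝ) : ℂ)) := by
    rw [chr_eq_cexp_real]
    congr 3
    push_cast
    ring
  have h3 : eR (fun t => ((k₀ : ℝ) / ((S : ℝ) * (M : ℝ) ^ (T - (t : ℕ))) + (kk : ℝ) * μ t) + (ν : ℝ) / (M : ℝ) ^ (T - (t : ℕ)))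
      (toZ fun t : Fin T => E / M ^ (t : ℕ) % M) =
      cexp (2 * Real.pi * I * (((kk : ℝ) * ∑ t : Fin T, μ t * ((E / M ^ (t : ℕ) % M : ℕ) : ℝ) : ℝ) : ℂ)) *
        cexp (2 * Real.pi * I * (((k₀ : ℝ) / S * E / (M : ℝ) ^ T : ℝ) : ℂ)) *
        cexp (2 * Real.pi * I * (((ν : ℝ) * E / (M : ℝ) ^ T : ℝ) : ℂ)) := by
    rw [eR_digits_shift hM _ (ν : ℝ) hEW']
    have e1 : (fun t : Fin T => (k₀ : ℝ) / ((S : ℝ) * (M : ℝ) ^ (T - (t : ℕ))) + (kk : ℝ) * μ t) =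
        fun t : Fin T => (kk : ℝ) * μ t + ((k₀ : ℝ) / S) / (M : ℝ) ^ (T - (t : ℕ)) := by
      funext t; rw [div_div]; ring
    rw [e1, eR_digits_shift hM _ ((k₀ : ℝ) / S) hEW']
    congr 2
    unfold eR toZ
    simp only [Int.cast_natCast]
    congr 3
    rw [mul_sum]
    exact sum_congr rfl fun t _ => by ring
  rw [h1, h2, h3]
  simp only [cexp_real_mul_cexp_real]
  refine cexp_real_eq_of_eq_add_int (-((m + ν) * (σ E : ℤ)) - kk * z) ?_
  -- the phase bookkeeping: `k₀ = kk + S m` and the exact-affine relation `hz`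
  have hmR : (k₀ : ℝ) = kk + S * m := by exact_mod_cast hm
  have hzR : (kk : ℝ) * ∑ t : Fin T, μ t * ((E / M ^ (t : ℕ) % M : ℕ) : ℝ) =
      (kk : ℝ) * ∑ t : Fin T, μ t * ((E₀ / M ^ (t : ℕ) % M : ℕ) : ℝ) + kk * z - kk * (y E - y E₀) / S := by
    have hsplit : (∑ t : Fin T, μ t * (((E / M ^ (t : ℕ) % M : ℕ) : ℝ) - ((E₀ / M ^ (t : ℕ) % M : ℕ) : ℝ))) =
        (∑ t : Fin T, μ t * ((E / M ^ (t : ℕ) % M : ℕ) : ℝ)) - ∑ t : Fin T, μ t * ((E₀ / M ^ (t : ℕ) % M : ℕ) : ℝ) := by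
      rw [← sum_sub_distrib]; exact sum_congr rfl fun t _ => by ring
    rw [hsplit] at hz
    field_simp
    linear_combination (kk : ℝ) * hz
  rw [hrK]
  push_cast
  rw [hzR, hmR]
  field_simp
  ring

end PeriodFinding

end Literature.Computability.Cryptography
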